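import Literature.AlgebraicGeometry.Frobenioids.GeometricFrobenioids
import Literature.AlgebraicGeometry.Frobenioids.ModelFrobenioidPowerFunctor
import Literature.AlgebraicGeometry.Frobenioids.ArithmeticFrobenioidIsotropic
import Literature.AlgebraicGeometry.Frobenioids.PreFrobenioidDataOfModel
import HarnessLib

/-!
# Frobenioids I, Example 6.1 / Theorem 6.2: the Frobenioid of geometric origin `C_{K̃/K}` — CONSTRUCTION,
# and Theorem 6.2 (ii) (Frobenius functor = naive Frobenius functor of degree `p`) — PROOF

Mochizuki, *The geometry of Frobenioids I*, Kyushu J. Math. **62** (2008), Example 6.1, kurims p. 109: from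
the geometric data (`V_K`, `D_K`, `K̃`) one forms the monoid `Φ : Spec L ↦ Φ(L)` of effective Cartier divisors
supported in `D_L`, the group-like monoid `B : Spec L ↦ B(L)` of rational functions regular outside `D_L`, and
the homomorphism `B → Φ^gp` "assigning to a rational function its divisor of zeroes and poles" — "`Φ`, `B` are
functorial in `L`" — and "by Theorem 5.2 (ii) this data determines a [model] Frobenioid `C_{K̃/K}`".
Theorem 6.2 (ii), p. 110: in characteristic `p`, the functor `Ψ : C → C` induced (via (i)) by the Frobenius
morphism "is isomorphic to the naive Frobenius functor of degree `p` on `C` [Prop. 2.1]"; proof p. 111: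
"both functors are obtained by raising to the `p`-th power". [cite: MochizukiFrdI2008, Ex. 6.1 p.109]

CONSTRUCTED / PROVED here (seat abc-iut-L6-t10; lead rulings R30 (B) / R37), over abc-iut-L1-t3's
`GeometricDivisorData` v2 (`GeometricFrobenioids.lean`: `pullPhi`, `mapB`, `div_mapB`, `div_mem_gp`,
`frobeniusPhi/B`), abc-iut-L1-t2's `ModelFrobenioid` (Thm. 5.2 (i)) and `naiveFrobeniusOf` (Prop. 2.1 (i)):
* `GeometricDivisorData.phiGpHom` (`Φ(L)^gp ↪ ℤ[D_L]`, injective) and `divPhi` (`B(L) → Φ(L)^gp`, the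
  divisor map through it, by `div_mem_gp`), natural (`phiGpHom_map`);
* `geomDivisorFunctor Γ`, `geomUnitsFunctor Γ : Dᵒᵖ ⥤ CommMonCat` and `geomDivNatTrans Γ : B ⟶ Φ^gp`;
* `geomFrobenioid Γ := ModelFrobenioid Φ B Div_B` — THE category `C_{K̃/K}`, with operations
  `geomFrobenioidOps Γ := PreFrobenioidData.ofModel …` and the packaging `geomModelFrobenioid Γ` as t3's
  `GeometricModelFrobenioid Γ` (`monEquiv = refl`, `monEquiv_natural = rfl`);
* `frobeniusPullbackFunctor Γ p` — the functor of Thm. 6.2 (ii) COMPUTED on the model: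
  `(Spec L, α) ↦ (Spec L, p·α)`, `(deg_Fr, Base, Div, u) ↦ (deg_Fr, Base, p·Div, u^p)` (its divisor and unit
  components are t3's `frobeniusPhi`, `frobeniusB`), and **`Thm62ii`** in the NAMED-functor form ruled by the
  lead: `Nonempty (frobeniusPullbackFunctor Γ p ≅ naiveFrobeniusOf hF p)` for `C` a Frobenioid (`hF`,
  Thm. 5.2 (ii), abc-iut-found) — PROVED (`Thm62ii_holds`, via `ModelFrobenioidPowerFunctor.lean`).
Nothing here asserts anything about abc.
-/

noncomputable section

namespace Literature.AlgebraicGeometry.Frobenioids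

open CategoryTheory Opposite

variable {K : Type} [Field K] {Kt : Type} [Field Kt] [Algebra K Kt] (Γ : GeometricDivisorData K Kt)

/-! ### `Φ(L)^gp ⊆ ℤ[D_L]` and the divisor map `B(L) → Φ(L)^gp` -/

namespace GeometricDivisorData

/-- `ℤ_{≥0}[D] → ℤ[D]` is injective. [cite: MochizukiFrdI2008, Ex. 6.1 p.109] -/
theorem toInt_injective {α : Type*} : Function.Injective (DivisorCoeff.toInt (α := α)) := by
  intro D E h
  ext a
  have := congrArg (fun F : α →₀ ℤ => F a) h
  simpa [DivisorCoeff.toInt_apply] using this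

/-- `Φ(L)^gp → ℤ[D_L]`: the group homomorphism extending `Φ(L) ⊆ ℤ_{≥0}[D_L] ⊆ ℤ[D_L]` to the
groupification. [cite: MochizukiFrdI2008, Ex. 6.1 p.109] -/
def phiGpHom (X : FinSubextCat K Kt) :
    Algebra.GrothendieckGroup (Multiplicative (Γ.Phi X)) →* Multiplicative (Γ.primeDiv X →₀ ℤ) :=
  Algebra.GrothendieckGroup.lift
    (AddMonoidHom.toMultiplicative (DivisorCoeff.toInt.comp (Γ.Phi X).subtype))

/-- `phiGpHom` on `Φ(L)`. [cite: MochizukiFrdI2008, Ex. 6.1 p.109] -/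
@[simp] theorem phiGpHom_of (X : FinSubextCat K Kt) (x : Multiplicative (Γ.Phi X)) :
    Γ.phiGpHom X (Algebra.GrothendieckGroup.of x) =
      Multiplicative.ofAdd (DivisorCoeff.toInt ((Multiplicative.toAdd x : Γ.Phi X) : Γ.primeDiv X →₀ ℕ)) := by
  have h := Algebra.GrothendieckGroup.lift.symm_apply_apply
    (AddMonoidHom.toMultiplicative (DivisorCoeff.toInt.comp (Γ.Phi X).subtype))
  rw [Algebra.GrothendieckGroup.lift_symm_apply] at h
  exact DFunLike.congr_fun h x

/-- Elements of a Grothendieck group are quotients of elements of the monoid. [folklore] -/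
private theorem mk_eq_of_div_of {M : Type*} [CommMonoid M] (m : M) (s : (⊤ : Submonoid M)) :
    (Localization.mk m s : Algebra.GrothendieckGroup M) =
      Algebra.GrothendieckGroup.of m / Algebra.GrothendieckGroup.of (s : M) := by
  rw [show Algebra.GrothendieckGroup.of m = Localization.mk m 1 from rfl,
    show Algebra.GrothendieckGroup.of (s : M) = Localization.mk (s : M) 1 from rfl,
    Algebra.GrothendieckGroup.mk_div_mk]
  congr 1
  · exact (mul_one m).symm
  · exact Subtype.ext (one_mul _).symm

/-- `Φ(L)^gp → ℤ[D_L]` is injective (`Φ(L)` is a cancellative submonoid of `ℤ_{≥0}[D_L]`).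
[cite: MochizukiFrdI2008, Ex. 6.1 p.109] -/
theorem phiGpHom_injective (X : FinSubextCat K Kt) : Function.Injective (Γ.phiGpHom X) := by
  refine (injective_iff_map_eq_one _).mpr fun x hx => ?_
  induction x using Localization.induction_on with
  | H y =>
    obtain ⟨m, s⟩ := y
    rw [mk_eq_of_div_of] at hx ⊢
    rw [map_div, div_eq_one, phiGpHom_of, phiGpHom_of] at hx
    have h := toInt_injective (Multiplicative.ofAdd.injective hx)
    rw [show m = (s : Multiplicative (Γ.Phi X)) from Multiplicative.toAdd.injective (Subtype.ext h), div_self']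

/-- `div(f) ∈ Φ(L)^gp` (the field `div_mem_gp`: `div f = D − E` with `D, E` Cartier effective).
[cite: MochizukiFrdI2008, Ex. 6.1 p.109] -/
theorem exists_phiGpHom_eq_div (X : FinSubextCat K Kt) (f : Γ.B X) : ∃ x, Γ.phiGpHom X x = Γ.div X f := by
  obtain ⟨D, hD, E, hE, h⟩ := Γ.div_mem_gp X f
  refine ⟨Algebra.GrothendieckGroup.of (Multiplicative.ofAdd ⟨D, hD⟩) /
    Algebra.GrothendieckGroup.of (Multiplicative.ofAdd ⟨E, hE⟩), ?_⟩
  rw [map_div, phiGpHom_of, phiGpHom_of, toAdd_ofAdd, toAdd_ofAdd, ← ofAdd_sub, ← ofAdd_toAdd (Γ.div X f), h]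

/-- **`B(L) → Φ(L)^gp`**, "assigning to a rational function its divisor of zeroes and poles" (FrdI p. 109),
valued in the groupification of `Φ(L)` (through the injection `phiGpHom`). [cite: MochizukiFrdI2008, Ex. 6.1 p.109] -/
def divPhi (X : FinSubextCat K Kt) : Γ.B X →* Algebra.GrothendieckGroup (Multiplicative (Γ.Phi X)) where
  toFun f := (Γ.exists_phiGpHom_eq_div X f).choose
  map_one' := Γ.phiGpHom_injective X (by
    rw [(Γ.exists_phiGpHom_eq_div X 1).choose_spec, map_one, map_one])
  map_mul' f g := Γ.phiGpHom_injective X (by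
    rw [(Γ.exists_phiGpHom_eq_div X (f * g)).choose_spec, map_mul, map_mul,
      (Γ.exists_phiGpHom_eq_div X f).choose_spec, (Γ.exists_phiGpHom_eq_div X g).choose_spec])

/-- `divPhi` is the divisor map: `phiGpHom (divPhi f) = div f`. [cite: MochizukiFrdI2008, Ex. 6.1 p.109] -/
@[simp] theorem phiGpHom_divPhi (X : FinSubextCat K Kt) (f : Γ.B X) :
    Γ.phiGpHom X (Γ.divPhi X f) = Γ.div X f :=
  (Γ.exists_phiGpHom_eq_div X f).choose_spec

/-- Naturality of `Φ^gp ⊆ ℤ[D]` with respect to pull-back. [cite: MochizukiFrdI2008, Ex. 6.1 p.109] -/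
theorem phiGpHom_map {X Y : FinSubextCat K Kt} (σ : Y ⟶ X)
    (x : Algebra.GrothendieckGroup (Multiplicative (Γ.Phi X))) :
    Γ.phiGpHom Y (MonGp.map (Γ.pullPhi σ) x) =
      AddMonoidHom.toMultiplicative (Γ.pull σ (R := ℤ)) (Γ.phiGpHom X x) := by
  have key : (Γ.phiGpHom Y).comp (MonGp.map (Γ.pullPhi σ)) =
      (AddMonoidHom.toMultiplicative (Γ.pull σ (R := ℤ))).comp (Γ.phiGpHom X) := by
    refine MonGp.hom_ext fun a => ?_
    rw [MonoidHom.comp_apply, MonoidHom.comp_apply, MonGp.map_of, phiGpHom_of, phiGpHom_of,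
      coe_toAdd_pullPhi, ← pull_toInt]
    rfl
  exact DFunLike.congr_fun key x

end GeometricDivisorData

/-! ### The monoids `Φ`, `B` on `D` and `Div_B : B → Φ^gp` -/

/-- **The monoid `Φ` of Example 6.1 on `D = B(Gal(K̃/K))⁰`**: `Spec L ↦ Φ(L)`, arrows ↦ pull-back (t3's
`pullPhi`), a `Dᵒᵖ ⥤ CommMonCat`. [cite: MochizukiFrdI2008, Ex. 6.1 p.109] -/
def geomDivisorFunctor : (FinSubextCat K Kt)ᵒᵖ ⥤ CommMonCat.{0} where
  obj X := CommMonCat.of (Multiplicative (Γ.Phi X.unop))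
  map f := CommMonCat.ofHom (Γ.pullPhi f.unop)
  map_id X := by
    apply CommMonCat.hom_ext
    rw [CommMonCat.hom_ofHom, CommMonCat.hom_id]
    exact MonoidHom.ext fun x => Γ.pullPhi_id _ x
  map_comp f g := by
    apply CommMonCat.hom_ext
    rw [CommMonCat.hom_ofHom, CommMonCat.hom_comp, CommMonCat.hom_ofHom, CommMonCat.hom_ofHom]
    exact MonoidHom.ext fun x => Γ.pullPhi_comp g.unop f.unop x

/-- **The monoid `B` of Example 6.1 on `D`**: `Spec L ↦ B(L)`, arrows ↦ `f ↦ f|_{V[L]}` (t3's `mapB`).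
[cite: MochizukiFrdI2008, Ex. 6.1 p.109] -/
def geomUnitsFunctor : (FinSubextCat K Kt)ᵒᵖ ⥤ CommMonCat.{0} where
  obj X := CommMonCat.of (Γ.B X.unop)
  map f := CommMonCat.ofHom (Γ.mapB f.unop)
  map_id X := by
    apply CommMonCat.hom_ext
    rw [CommMonCat.hom_ofHom, CommMonCat.hom_id]
    exact MonoidHom.ext fun x => Γ.mapB_id _ x
  map_comp f g := by
    apply CommMonCat.hom_ext
    rw [CommMonCat.hom_ofHom, CommMonCat.hom_comp, CommMonCat.hom_ofHom, CommMonCat.hom_ofHom]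
    exact MonoidHom.ext fun x => Γ.mapB_comp g.unop f.unop x

/-- **`B → Φ^gp`**, the divisor homomorphism of Example 6.1 as a homomorphism of monoids on `D` (naturality
from t3's `div_mapB`). [cite: MochizukiFrdI2008, Ex. 6.1 p.109] -/
def geomDivNatTrans : geomUnitsFunctor Γ ⟶ monoidGp (geomDivisorFunctor Γ) where
  app X := CommMonCat.ofHom (Γ.divPhi X.unop)
  naturality X Y f := by
    apply CommMonCat.hom_ext
    refine MonoidHom.ext fun u => ?_
    change Γ.divPhi Y.unop (Γ.mapB f.unop u) = MonGp.map (Γ.pullPhi f.unop) (Γ.divPhi X.unop u)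
    apply Γ.phiGpHom_injective
    rw [GeometricDivisorData.phiGpHom_divPhi, GeometricDivisorData.phiGpHom_map,
      GeometricDivisorData.phiGpHom_divPhi]
    exact (congrArg Multiplicative.ofAdd (Γ.div_mapB f.unop u) : _)

/-- **The Frobenioid of geometric origin `C_{K̃/K}`** of Example 6.1 (FrdI p. 109): the model Frobenioid of
Thm. 5.2 (i)/(ii) (`ModelFrobenioid`, abc-iut-L1-t2) of the data `(Φ, B, B → Φ^gp)` over `D = B(Gal(K̃/K))⁰`.
[cite: MochizukiFrdI2008, Ex. 6.1 p.109] -/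
abbrev geomFrobenioid : Type :=
  ModelFrobenioid (geomDivisorFunctor Γ) (geomUnitsFunctor Γ) (geomDivNatTrans Γ)

/-- The operations `(Base, Div, deg_Fr)` of `C_{K̃/K}` (abc-iut-L1-t3's `PreFrobenioidData.ofModel`).
[cite: MochizukiFrdI2008, Ex. 6.1 p.109] -/
abbrev geomFrobenioidOps : PreFrobenioidData.{0} (geomFrobenioid Γ) (FinSubextCat K Kt) :=
  PreFrobenioidData.ofModel (geomDivisorFunctor Γ) (geomUnitsFunctor Γ) (geomDivNatTrans Γ)

/-- **`C_{K̃/K}` packaged as abc-iut-L1-t3's `GeometricModelFrobenioid Γ`**: its divisor monoid at `Spec L`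
IS `Φ(L)` (`monEquiv = refl`) and its pull-back IS `σ^*` (`monEquiv_natural = rfl`); this binds the
parameter `M` of `Thm62iii` / `Thm62iv`. [cite: MochizukiFrdI2008, Thm. 6.2 p.110] -/
def geomModelFrobenioid : GeometricModelFrobenioid Γ (geomFrobenioid Γ) where
  ops := geomFrobenioidOps Γ
  monEquiv _ := MulEquiv.refl _
  monEquiv_natural _ _ := rfl

/-- The operations of the packaged model are `geomFrobenioidOps` (unfolding). [cite: MochizukiFrdI2008, Thm. 6.2 p.110] -/
@[simp] theorem geomModelFrobenioid_ops : (geomModelFrobenioid Γ).ops = geomFrobenioidOps Γ := rfl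

/-- The rational-function monoid `B` of Example 6.1 is group-like (each `B(L)` is a group).
[cite: MochizukiFrdI2008, Ex. 6.1 p.109] -/
theorem geomUnitsFunctor_isGroupLike : Objectwise (fun M _ => IsGroupLike M) (geomUnitsFunctor Γ) :=
  fun X => isGroupLike_of_commGroup (Γ.B X)

/-! ### Theorem 6.2 (ii): the Frobenius functor is the naive Frobenius functor of degree `p` -/

/-- **The functor `Ψ : C → C` induced by the Frobenius morphism** (Thm. 6.2 (ii) via (i)), COMPUTED on the
model: `(Spec L, α) ↦ (Spec L, p·α)` (base functor the identity, `L = K·L^p`; pull-back along Frobenius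
multiplies Cartier divisors by `p`), `(deg_Fr, Base, Div, u) ↦ (deg_Fr, Base, p·Div, u^p)` ("raising to the
`p`-th power", p. 111). [cite: MochizukiFrdI2008, Thm. 6.2 (ii) p.110] -/
def frobeniusPullbackFunctor (p : ℕ+) : geomFrobenioid Γ ⥤ geomFrobenioid Γ :=
  ModelFrobenioid.powFunctor (geomDivisorFunctor Γ) (geomUnitsFunctor Γ) (geomDivNatTrans Γ) p

/-- The divisor component of `Ψ(φ)` is t3's Frobenius datum `frobeniusPhi p` applied to `Div(φ)`.
[cite: MochizukiFrdI2008, Thm. 6.2 (ii) p.111] -/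
theorem div_frobeniusPullbackFunctor_map (p : ℕ+) {A A' : geomFrobenioid Γ} (φ : A ⟶ A') :
    ModelFrobenioid.div ((frobeniusPullbackFunctor Γ p).map φ) =
      Γ.frobeniusPhi p A.base (ModelFrobenioid.div φ) := rfl

/-- The unit component of `Ψ(φ)` is t3's Frobenius datum `frobeniusB p` applied to `u_φ` (`u ↦ u^p`).
[cite: MochizukiFrdI2008, Thm. 6.2 (ii) p.111] -/
theorem unit_frobeniusPullbackFunctor_map (p : ℕ+) {A A' : geomFrobenioid Γ} (φ : A ⟶ A') :
    ModelFrobenioid.unit ((frobeniusPullbackFunctor Γ p).map φ) =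
      Γ.frobeniusB p A.base (ModelFrobenioid.unit φ) := rfl

/-- `Ψ` on objects: `(Spec L, α) ↦ (Spec L, p·α)`. [cite: MochizukiFrdI2008, Thm. 6.2 (ii) p.111] -/
theorem frobeniusPullbackFunctor_obj (p : ℕ+) (A : geomFrobenioid Γ) :
    (frobeniusPullbackFunctor Γ p).obj A = ⟨A.base, A.cls ^ (p : ℕ)⟩ := rfl

/-- **Theorem 6.2 (ii)** (FrdI p. 110), in the named-functor form ruled by the cell lead (R30 (B)): for a prime
`p` with `char K = p`, the Frobenius functor `Ψ` on `C_{K̃/K}` is isomorphic to the naive Frobenius functor of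
degree `p` of Prop. 2.1 (abc-iut-L1-t2's `naiveFrobeniusOf`, which requires `C` to be a Frobenioid — Thm. 5.2 (ii),
abc-iut-found; taken as the hypothesis `hF`). [cite: MochizukiFrdI2008, Thm. 6.2 (ii) p.110] -/
def Thm62ii (p : ℕ) [Fact p.Prime] [CharP K p] : Prop :=
  ∀ hF : PreFrobenioid.IsFrobenioid
      (ModelFrobenioid.toElem (geomDivisorFunctor Γ) (geomUnitsFunctor Γ) (geomDivNatTrans Γ)),
    Nonempty (frobeniusPullbackFunctor Γ ⟨p, (Fact.out : p.Prime).pos⟩ ≅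
      PreFrobenioid.naiveFrobeniusOf hF ⟨p, (Fact.out : p.Prime).pos⟩)

/-- **Theorem 6.2 (ii) — PROVED** ("both functors are obtained by raising to the `p`-th power", p. 111; here:
`(p, id, 0, 0)` is a morphism of Frobenius type of degree `p` and the Prop. 1.10 (i) lift along it is
`(deg_Fr, Base, p·Div, u^p)`, `ModelFrobenioidPowerFunctor.lean`). [cite: MochizukiFrdI2008, Thm. 6.2 (ii) p.110] -/
theorem Thm62ii_holds (p : ℕ) [Fact p.Prime] [CharP K p] : Thm62ii Γ p := fun hF =>
  ModelFrobenioid.nonempty_powFunctor_iso_naiveFrobeniusOf _ _ _ (geomUnitsFunctor_isGroupLike Γ) hF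

/-! ### Theorem 6.2 (iii): the dischargeable conjuncts for the constructed model -/

/-- **Theorem 6.2 (iii), "`C` is of isotropic type"** — PROVED for the constructed `C_{K̃/K}` (Thm. 5.2 (ii) via
abc-iut-L1-t2's `ModelFrobenioid.ofModel_isOfIsotropicType`; `B` is group-like).
[cite: MochizukiFrdI2008, Thm. 6.2 (iii) p.111] -/
theorem isOfIsotropicType_geom : (geomFrobenioidOps Γ).IsOfIsotropicType :=
  ModelFrobenioid.ofModel_isOfIsotropicType _ _ _ (geomUnitsFunctor_isGroupLike Γ)

/-- **Theorem 6.2 (iii), "but not of group-like type"** — PROVED for the constructed `C_{K̃/K}` as soon as some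
`Φ(L)` is nonzero ("`Φ` is easily seen to be non-dilating [and nonzero]", p. 111; for a proper normal variety of
positive dimension a nonzero effective Cartier divisor supported in `D_L ≠ ∅` exists — this nontriviality is
NOT a field of the interface `GeometricDivisorData`, so it is the explicit hypothesis `h`).
[cite: MochizukiFrdI2008, Thm. 6.2 (iii) p.111] -/
theorem not_isOfGroupLikeType_geom
    (h : ∃ (X : FinSubextCat K Kt) (D : Γ.Phi X), ((D : Γ.Phi X) : Γ.primeDiv X →₀ ℕ) ≠ 0) :
    ¬ (geomFrobenioidOps Γ).IsOfGroupLikeType := by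
  obtain ⟨X, D, hD⟩ := h
  intro hgl
  have h1 := (ModelFrobenioid.data_isOfGroupLikeType_iff (geomDivisorFunctor Γ) (geomUnitsFunctor Γ)
    (geomDivNatTrans Γ)).mp hgl (op X) (Multiplicative.ofAdd D)
  exact hD (by rw [Multiplicative.ofAdd.injective h1]; rfl)

/-- **Theorem 6.2 (iii)** for the constructed model, REDUCED: given a nonzero Cartier divisor, t3's named
statement `Thm62iii (geomModelFrobenioid Γ) Bi R` is equivalent to its remaining conjuncts — standard type,
birationally Frobenius-normalized type of the birationalization data `Bi`, and the rationally-standard clause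
over `R` (these quote Thm. 5.2 (iii) / Prop. 4.4 / Def. 4.5 data not constructed in this file).
[cite: MochizukiFrdI2008, Thm. 6.2 (iii) p.111] -/
theorem Thm62iii_iff_of_exists_ne_zero
    (h : ∃ (X : FinSubextCat K Kt) (D : Γ.Phi X), ((D : Γ.Phi X) : Γ.primeDiv X →₀ ℕ) ≠ 0)
    (Bi : (geomModelFrobenioid Γ).ops.BiratData) (R : (geomModelFrobenioid Γ).ops.RSParams) :
    Thm62iii (geomModelFrobenioid Γ) Bi R ↔
      ((geomFrobenioidOps Γ).IsOfStandardType ∧ PreFrobenioidData.IsOfBiratFrobeniusNormalizedType Bi ∧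
        ((∀ (X : FinSubextCat K Kt) (P : Γ.primeDiv X), ∃ f : Γ.B X,
            (Multiplicative.toAdd (Γ.div X f)) P ≠ 0) → (geomFrobenioidOps Γ).IsOfRationallyStandardType R)) :=
  ⟨fun hT => ⟨hT.2.1, hT.2.2.1, hT.2.2.2.2⟩,
    fun hT => ⟨isOfIsotropicType_geom Γ, hT.1, hT.2.1, not_isOfGroupLikeType_geom Γ h, hT.2.2⟩⟩

end Literature.AlgebraicGeometry.Frobenioids

end
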